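import Summits.Ventures.PercRepro.C041ZonePortCSDefs

/-!
# THEOREM R-CS on the zone port problem — case (ii), a gate carrying both terminal types (p6, gen 28)

Setting of `C041ZonePortCSDefs` (mine-3, C-041.md §17 (a) (ii)).  Some gate zone `C` carries a 1-edge `e₁` and a
2-edge `e₂`.  The valid patterns are grouped into the FIBRES of the reddening map `redden C` (all edges at `C` red,
the other ports untouched — the paper's «per group `x′`»); in the fibre of `r`:

* `r` itself is valid and Good on both sides (a red 2-edge and a red 1-edge at a gate with no blue edge, THE KEY
  FACT — `good₁_of_allRed`, `good₂_of_allRed`), so `#Good₁ ≥ 1`, `#Good₂ ≥ 1` and `#(Good₁ ∩ Good₂) ≥ 1` there;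
* a pattern of the fibre that is Good on neither side is one of TWO: all 1-edges at `C` blue (`blue₁ C r`; then the
  2-edges at `C` are red by admissibility, and a red 1-edge at `C` would give `Good₂`) or all 2-edges at `C` blue
  (`blue₂ C r`; a red 2-edge would give `Good₁`) — `eq_blue_of_not_good`;

hence `#valid ≤ #Good₁ + #Good₂ − 1 + 2` in the fibre, i.e. the excess is `≤ 1 ≤ #Good₁ · #Good₂`: (CS) per fibre
(`cs_fibre`), and (CS) for the whole by the CAUCHY–SCHWARZ sum (`cs_of_fibres`): **`csOr_of_twoType_gate`**.  This is
the paper's `v − x − y ≤ 1 ≤ (2^{k₁} − 1)(2^{k₂} − 1)` per group without computing the group sizes.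
-/

namespace PercRepro

namespace ZonePort

namespace Problem

open Finset CSCount

variable {V E : Type*}

section AllRed

variable {P : Problem V E}

/-- All edges red at a gate with a 2-edge: `Good₁`. -/
theorem good₁_of_allRed {C : Finset V} (hC : P.IsGate C) {e₂ : P.Term} (he₂ : P.tz e₂.1 = C)
    (hs₂ : P.ts e₂.1 = true) {x : P.Term → Bool} (hx : P.AllRed C x) : P.Good₁ x :=
  good₁_of_red_gate (he₂ ▸ hC) hs₂ (hx e₂ he₂) (fun f hf _ => hx f (hf.trans he₂))

/-- All edges red at a gate with a 1-edge: `Good₂`. -/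
theorem good₂_of_allRed {C : Finset V} (hC : P.IsGate C) {e₁ : P.Term} (he₁ : P.tz e₁.1 = C)
    (hs₁ : P.ts e₁.1 = false) {x : P.Term → Bool} (hx : P.AllRed C x) : P.Good₂ x :=
  good₂_of_red_gate (he₁ ▸ hC) hs₁ (hx e₁ he₁) (fun f hf _ => hx f (hf.trans he₁))

end AllRed

section Blue

variable [DecidableEq V] {P : Problem V E}

/-- All 1-edges at the zone `C` made blue, the other edges untouched. -/
def blue₁ (P : Problem V E) (C : Finset V) (x : P.Term → Bool) : P.Term → Bool :=
  fun f => if P.tz f.1 = C ∧ P.ts f.1 = false then false else x f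

/-- All 2-edges at the zone `C` made blue, the other edges untouched. -/
def blue₂ (P : Problem V E) (C : Finset V) (x : P.Term → Bool) : P.Term → Bool :=
  fun f => if P.tz f.1 = C ∧ P.ts f.1 = true then false else x f

/-- Reddening is idempotent. -/
theorem redden_redden (C : Finset V) (x : P.Term → Bool) : P.redden C (P.redden C x) = P.redden C x := by
  funext f
  by_cases hf : P.tz f.1 = C
  · rw [redden_of_tz C _ hf, redden_of_tz C x hf]
  · rw [redden_of_ne C _ hf, redden_of_ne C x hf]

/-- Reddening keeps validity. -/
theorem validOr_redden {x : P.Term → Bool} (hx : P.ValidOr x) (C : Finset V) : P.ValidOr (P.redden C x) :=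
  ⟨adm_redden hx.1 C, hx.2.elim (fun h => Or.inl (X₁_redden h C)) (fun h => Or.inr (X₂_redden h C))⟩

/-- **A pattern of the fibre of `r` that is Good on neither side is `blue₁ C r` or `blue₂ C r`.** -/
theorem eq_blue_of_not_good {C : Finset V} (hC : P.IsGate C) {x : P.Term → Bool} (hx : P.Adm x)
    (h1 : ¬ P.Good₁ x) (h2 : ¬ P.Good₂ x) :
    x = P.blue₁ C (P.redden C x) ∨ x = P.blue₂ C (P.redden C x) := by
  by_cases hA : ∀ f : P.Term, P.tz f.1 = C → P.ts f.1 = false → x f = true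
  · -- all 1-edges at `C` red: every 2-edge at `C` is blue
    have hB : ∀ f : P.Term, P.tz f.1 = C → P.ts f.1 = true → x f = false := by
      intro f hf hs
      by_contra hne
      have hred : x f = true := by
        cases h : x f
        · exact absurd h hne
        · rfl
      exact h1 (good₁_of_red_gate (hf ▸ hC) hs hred (fun g hg hgs => hA g (hg.trans hf) hgs))
    right
    funext f
    unfold blue₂
    by_cases hf : P.tz f.1 = C
    · cases hs : P.ts f.1
      · rw [if_neg (fun h => Bool.noConfusion h.2), redden_of_tz C x hf]
        exact hA f hf hs
      · rw [if_pos ⟨hf, rfl⟩]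
        exact hB f hf hs
    · rw [if_neg (fun h => hf h.1), redden_of_ne C x hf]
  · -- some 1-edge at `C` blue: every 2-edge at `C` red, hence every 1-edge at `C` blue
    push Not at hA
    obtain ⟨g, hgC, hgs, hxg⟩ := hA
    have hxg' : x g = false := Bool.eq_false_iff.2 hxg
    have hB : ∀ f : P.Term, P.tz f.1 = C → P.ts f.1 = true → x f = true := by
      intro f hf hs
      rcases hx.2 g f (hgC.trans hf.symm) hgs hs with h | h
      · rw [hxg'] at h
        exact Bool.noConfusion h
      · exact h
    have hA' : ∀ f : P.Term, P.tz f.1 = C → P.ts f.1 = false → x f = false := by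
      intro f hf hs
      by_contra hne
      have hred : x f = true := by
        cases h : x f
        · exact absurd h hne
        · rfl
      exact h2 (good₂_of_red_gate (hf ▸ hC) hs hred (fun g' hg' hgs' => hB g' (hg'.trans hf) hgs'))
    left
    funext f
    unfold blue₁
    by_cases hf : P.tz f.1 = C
    · cases hs : P.ts f.1
      · rw [if_pos ⟨hf, rfl⟩]
        exact hA' f hf hs
      · rw [if_neg (fun h => Bool.noConfusion h.2), redden_of_tz C x hf]
        exact hB f hf hs
    · rw [if_neg (fun h => hf h.1), redden_of_ne C x hf]

end Blue

section Fibres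

variable [Fintype E] [DecidableEq E] [DecidableEq V] {P : Problem V E}

open Classical in
/-- The fibre of `r` among the valid patterns. -/
noncomputable def fibV (P : Problem V E) (C : Finset V) (r : P.Term → Bool) : Finset (P.Term → Bool) :=
  P.validSet.filter fun x => P.redden C x = r

open Classical in
/-- The fibre of `r` among the valid `Good₁` patterns. -/
noncomputable def fibG₁ (P : Problem V E) (C : Finset V) (r : P.Term → Bool) : Finset (P.Term → Bool) :=
  P.good₁Set.filter fun x => P.redden C x = r

open Classical in
/-- The fibre of `r` among the valid `Good₂` patterns. -/
noncomputable def fibG₂ (P : Problem V E) (C : Finset V) (r : P.Term → Bool) : Finset (P.Term → Bool) :=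
  P.good₂Set.filter fun x => P.redden C x = r

/-- The valid patterns are the sum of the fibres. -/
theorem card_validSet_eq_sum_fibV (C : Finset V) : #(P.validSet) = ∑ r, #(P.fibV C r) := by
  classical
  exact card_eq_sum_card_fiberwise fun _ _ => Finset.mem_univ _

/-- The valid `Good₁` patterns are the sum of the fibres. -/
theorem card_good₁Set_eq_sum_fibG₁ (C : Finset V) : #(P.good₁Set) = ∑ r, #(P.fibG₁ C r) := by
  classical
  exact card_eq_sum_card_fiberwise fun _ _ => Finset.mem_univ _

/-- The valid `Good₂` patterns are the sum of the fibres. -/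
theorem card_good₂Set_eq_sum_fibG₂ (C : Finset V) : #(P.good₂Set) = ∑ r, #(P.fibG₂ C r) := by
  classical
  exact card_eq_sum_card_fiberwise fun _ _ => Finset.mem_univ _

/-- Membership in a valid fibre. -/
theorem mem_fibV {C : Finset V} {r x : P.Term → Bool} : x ∈ P.fibV C r ↔ P.ValidOr x ∧ P.redden C x = r := by
  classical
  unfold fibV
  rw [Finset.mem_filter, mem_validSet]

/-- Membership in a `Good₁` fibre. -/
theorem mem_fibG₁ {C : Finset V} {r x : P.Term → Bool} :
    x ∈ P.fibG₁ C r ↔ (P.ValidOr x ∧ P.Good₁ x) ∧ P.redden C x = r := by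
  classical
  unfold fibG₁
  rw [Finset.mem_filter, mem_good₁Set]

/-- Membership in a `Good₂` fibre. -/
theorem mem_fibG₂ {C : Finset V} {r x : P.Term → Bool} :
    x ∈ P.fibG₂ C r ↔ (P.ValidOr x ∧ P.Good₂ x) ∧ P.redden C x = r := by
  classical
  unfold fibG₂
  rw [Finset.mem_filter, mem_good₂Set]

/-- **(CS) in every fibre** of the reddening map at a gate carrying both terminal types. -/
theorem cs_fibre {C : Finset V} (hC : P.IsGate C) {e₁ e₂ : P.Term} (he₁ : P.tz e₁.1 = C) (he₂ : P.tz e₂.1 = C)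
    (hs₁ : P.ts e₁.1 = false) (hs₂ : P.ts e₂.1 = true) (r : P.Term → Bool) :
    CS #(P.fibV C r) #(P.fibG₁ C r) #(P.fibG₂ C r) := by
  classical
  by_cases hne : (P.fibV C r).Nonempty
  · obtain ⟨x₀, hx₀⟩ := hne
    rw [mem_fibV] at hx₀
    -- `r` is valid, all red at `C`, in its own fibre, Good on both sides
    have hrv : P.ValidOr r := hx₀.2 ▸ validOr_redden hx₀.1 C
    have hrr : P.redden C r = r := by
      rw [← hx₀.2, redden_redden]
    have hrR : P.AllRed C r := hx₀.2 ▸ allRed_redden C x₀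
    have hr1 : r ∈ P.fibG₁ C r := mem_fibG₁.2 ⟨⟨hrv, good₁_of_allRed hC he₂ hs₂ hrR⟩, hrr⟩
    have hr2 : r ∈ P.fibG₂ C r := mem_fibG₂.2 ⟨⟨hrv, good₂_of_allRed hC he₁ hs₁ hrR⟩, hrr⟩
    -- the fibre is covered by the two Good fibres and the two blue patterns
    have hcover : P.fibV C r ⊆ P.fibG₁ C r ∪ P.fibG₂ C r ∪ {P.blue₁ C r, P.blue₂ C r} := by
      intro x hx
      rw [mem_fibV] at hx
      by_cases h1 : P.Good₁ x
      · exact mem_union_left _ (mem_union_left _ (mem_fibG₁.2 ⟨⟨hx.1, h1⟩, hx.2⟩))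
      by_cases h2 : P.Good₂ x
      · exact mem_union_left _ (mem_union_right _ (mem_fibG₂.2 ⟨⟨hx.1, h2⟩, hx.2⟩))
      apply mem_union_right
      rw [Finset.mem_insert, Finset.mem_singleton]
      rcases eq_blue_of_not_good hC hx.1.1 h1 h2 with h | h
      · left
        rw [h, hx.2]
      · right
        rw [h, hx.2]
    have c1 : #(P.fibV C r) ≤ #(P.fibG₁ C r ∪ P.fibG₂ C r ∪ {P.blue₁ C r, P.blue₂ C r}) := card_le_card hcover
    have c2 : #(P.fibG₁ C r ∪ P.fibG₂ C r ∪ {P.blue₁ C r, P.blue₂ C r}) ≤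
        #(P.fibG₁ C r ∪ P.fibG₂ C r) + #({P.blue₁ C r, P.blue₂ C r} : Finset (P.Term → Bool)) :=
      card_union_le _ _
    have c3 : #({P.blue₁ C r, P.blue₂ C r} : Finset (P.Term → Bool)) ≤ 2 := card_le_two
    have c4 : #(P.fibG₁ C r ∪ P.fibG₂ C r) + #(P.fibG₁ C r ∩ P.fibG₂ C r) = #(P.fibG₁ C r) + #(P.fibG₂ C r) :=
      card_union_add_card_inter _ _
    have c5 : 1 ≤ #(P.fibG₁ C r ∩ P.fibG₂ C r) := one_le_card.2 ⟨r, mem_inter.2 ⟨hr1, hr2⟩⟩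
    have c6 : 1 ≤ #(P.fibG₁ C r) := one_le_card.2 ⟨r, hr1⟩
    have c7 : 1 ≤ #(P.fibG₂ C r) := one_le_card.2 ⟨r, hr2⟩
    have hd : #(P.fibV C r) - #(P.fibG₁ C r) - #(P.fibG₂ C r) ≤ 1 := by omega
    unfold CS
    calc (#(P.fibV C r) - #(P.fibG₁ C r) - #(P.fibG₂ C r)) ^ 2 ≤ 1 ^ 2 := Nat.pow_le_pow_left hd 2
      _ = 1 * 1 := by norm_num
      _ ≤ #(P.fibG₁ C r) * #(P.fibG₂ C r) := Nat.mul_le_mul c6 c7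
  · rw [Finset.not_nonempty_iff_eq_empty] at hne
    rw [hne, Finset.card_empty]
    exact cs_of_le (Nat.zero_le _)

/-- **Case (ii)**: a gate carrying both terminal types gives (CS) — fibre by fibre of the reddening map, then the
CAUCHY–SCHWARZ sum. -/
theorem csOr_of_twoType_gate {C : Finset V} (hC : P.IsGate C) {e₁ e₂ : P.Term} (he₁ : P.tz e₁.1 = C)
    (he₂ : P.tz e₂.1 = C) (hs₁ : P.ts e₁.1 = false) (hs₂ : P.ts e₂.1 = true) : P.CSOr := by
  unfold CSOr
  rw [card_validSet_eq_sum_fibV C, card_good₁Set_eq_sum_fibG₁ C, card_good₂Set_eq_sum_fibG₂ C]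
  exact cs_of_fibres _ _ _ _ fun r _ => cs_fibre hC he₁ he₂ hs₁ hs₂ r

end Fibres

end Problem

end ZonePort

end PercRepro
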